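import Summits.QuantumFields.YangMills.Theorems.UV3BranchExpansionDefectTransport
import HarnessLib

/-!
# R3 (cell `ym3-torus`, YM₃ on T³ — a ladder RUNG, NOT d = 4, NOT infinite volume, NOT a mass gap, NOT the Clay problem) —
# **(M) MUTE-SITE COUPLING: along a branch of the expansion, toggling the EML∕axial choice at a site whose defect climbs a tower of unread
# coordinates and meets a FRESH slot leaves the branch measure UNCHANGED — `μ_{𝐬,𝐬′} = μ_{𝐬,𝐬′ △ σ}` — by transport of the defect and ONE coupling**

Width seat `ym-ust-19936-w8` g12 on crux `stmt-QuantumFields-19936` `UnitScaleTilt.HistoryTailL` (`--supports`, helper; THEOREMS ONLY, 0 `def`, 0 `sorry`).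
Lemma (M) of LEAD ★w1 g12's `Cruxes/HistoryTailL/HTopBranchExpansion.md` §4 in the level-by-level COUPLING form (w8 g12, bus 03:44Z; LEAD's own engine for the one-slot Fubini
form is ✓`UV3BranchExpansionOneSlotField`).  ABSTRACT OVER THE ONE-STEP MAPS: two families `T, T′` of measurable maps between consecutive gauge-field levels that coincide
except at ONE height `k`, where they agree at every coordinate outside a set `D_{k+1}` (the EML and the axial branch at the toggled bond); guard events `E_n` restricting each
level; the DEFECT is transported while `E_n` and the off-`D_{n+1}` coordinates of `T_n` do not read `D_n` (heights `k < n < e`); at the EXIT height `e` the map is the straight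
transporter at a bond `C` whose segment has a slot `β_e := line C (τ C)` that is FRESH — i.e. sits on top of a chain of slots `β_n = line β_{n+1} (σ_n β_{n+1})` down to level
`j`, unread by every `E_n` and by every coordinate of `T_n` other than `β_{n+1}`, with `T_n` axial at `β_{n+1}`.  CONCLUSION: the two branch measures
`(dU_j ↾ {∀ n < N, V_n ∈ E_n}).map V_N` coincide for every `N > e` in the standing range.  The model-specific discharge of the blindness letters from the read sets of the
(0.4) guards (✓`BalabanUVNodesN08GuardReadSet`) and the tower∕chain bookkeeping (`Dist`, `Read`) is (F-M1), not here.
RECORD CURRENCY (★★OWNER WORDS 84 (2) ∕ 85 (4) ∕ ACK 145): record-independent kinematics of product Haar and the straight transporter; SUPPLY-side for the hTop-class rows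
`fibre55Win` ∕ `fibre57LowOn` of the χ record inside NODE O B3 and for Track A's N08 — NOT a 19936 registry row.

THE ARGUMENT.  `μ_n, μ′_n` (the two branch measures at height `n`, §3 recursion of ✓`UV3BranchExpansionDefectTransport`) are EQUAL for `n ≤ k`, AGREE OFF `D_{k+1}` at `k+1`
(`agreeOff_map_restrict_of_maps`), agree off `D_n` for `k < n ≤ e` (`agreeOff_map_restrict`), and are EQUAL at `e+1` by ✓`UV3AxialLaunderingOverwrite.map_eq_of_marginal_eq`
(`Λ = {C}`: both restricted laws are fresh at the slot — freshness climbed from `dU_j` by `fresh_map_of_fresh` ∕ `fresh_restrict` —, `T_e` is axial at `C`, and the blanked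
images agree because they do not read `D_e`); above `e` the maps coincide.

CONTENTS.  §1 `fresh_traj` (freshness of the branch measures along the slot chain) · `agreeOff_traj` (the defect climbs the tower) · ★★★ `map_restrict_traj_eq_of_mute` (M).

HONEST SCOPE.  [folklore] measure theory over ✓p757085 ∕ ✓p757669 ∕ ✓`UV3BranchExpansionDefectTransport`; the blindness ∕ axiality ∕ chain letters are HYPOTHESES (their
discharge for the hybrids of a mute site is (F-M1)); nothing of (C), hTop, (T8), (O‴χₛ), `HistoryTailL` (19936), the rung, d = 4, a mass gap or Clay is proved here.
YM₃ on T³ is rung R3 of the ladder, not the Clay problem.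

References: T. Bałaban, Commun. Math. Phys. **98** (1985) 17–51 [Balaban1985Averaging] ((10) p. 19, (b) p. 23); T. Bałaban, Commun. Math. Phys. **109** (1987) 249–301
[Balaban1987RG1] ((0.4) p. 253); T. Bałaban, Commun. Math. Phys. **102** (1985) 255–275 [Balaban1985UV3] ((2) p. 256, the k-fold transport).
-/

set_option autoImplicit false

noncomputable section

open MeasureTheory Set Function
open scoped ENNReal

namespace Summit.QuantumFields.YangMills.Theorems.UV3BranchExpansionMuteCoupling

open Literature.MathematicalPhysics.QuantumFieldTheory.Balaban1983to89
open Literature.MathematicalPhysics.QuantumFieldTheory.Balaban1983to89.AveragingRT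
open Summit.QuantumFields.YangMills.Theorems.UV3AxialLaunderingOverwrite (map_eq_of_marginal_eq measurable_piecewise_overwrite)
open Summit.QuantumFields.YangMills.Theorems.UV3BranchExpansionDomination (measurable_iterate)
open Summit.QuantumFields.YangMills.Theorems.UV3BranchExpansionDefectTransport

variable {P : Params} {j : ℕ} {G : Type*} [GaugeGroup G] [MeasurableSpace G] [HaarData G] [MeasurableMul₂ G]

/-- **FRESHNESS OF THE BRANCH MEASURES ALONG A SLOT CHAIN**: if `β_n = line β_{n+1} (σ_n β_{n+1})` for `n < e`, every guard event `E_n` (`n ≤ e`) is `β_n`-blind, and every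
one-step map `T_n` (`n < e`) is the straight transporter at `β_{n+1}` with its other coordinates `β_n`-blind, then the branch measure at height `n ≤ e` is FRESH at `β_n`:
right-multiplying the coordinate `β_n` by any group element leaves `(dU_j ↾ {∀ i < n, V_i ∈ E_i}).map V_n` invariant (standing range). [cite: Balaban1985Averaging, (10) p.19, (b) p.23] -/
theorem fresh_traj (e : ℕ) (hje : j + e ≤ P.m + P.K)
    (T : (n : ℕ) → GaugeField P (j + n) G → GaugeField P (j + n + 1) G) (hT : ∀ n, Measurable (T n))
    (E : (n : ℕ) → Set (GaugeField P (j + n) G)) (hE : ∀ n, MeasurableSet (E n))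
    (V : (n : ℕ) → GaugeField P j G → GaugeField P (j + n) G) (hV0 : ∀ U, V 0 U = U) (hVs : ∀ n U, V (n + 1) U = T n (V n U))
    (β : (n : ℕ) → PBond P (j + n)) (σ : (n : ℕ) → PBond P (j + n + 1) → ℕ) (hσ : ∀ n c, σ n c < P.L)
    (hβσ : ∀ n, n < e → β n = line (β (n + 1)) (σ n (β (n + 1))))
    (hEβ : ∀ n, n ≤ e → ∀ U U' : GaugeField P (j + n) G, (∀ b', b' ≠ β n → U b' = U' b') → (U ∈ E n ↔ U' ∈ E n))
    (hTβ : ∀ n, n < e → ∀ U, T n U (β (n + 1)) = axialAvg U (β (n + 1)))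
    (hTβ' : ∀ n, n < e → ∀ U U' : GaugeField P (j + n) G, (∀ b', b' ≠ β n → U b' = U' b') → ∀ c, c ≠ β (n + 1) → T n U c = T n U' c) :
    ∀ n, n ≤ e → ∀ g : G,
      (((fieldMeasure P j G).restrict {U | ∀ i < n, V i U ∈ E i}).map (V n)).map
          (fun (W : GaugeField P (j + n) G) (b' : PBond P (j + n)) => W b' * ({β n} : Set (PBond P (j + n))).mulIndicator (fun _ => g) b') =
        ((fieldMeasure P j G).restrict {U | ∀ i < n, V i U ∈ E i}).map (V n) := by
  intro n
  induction n with
  | zero =>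
    intro _ g
    rw [map_restrict_traj_zero (fieldMeasure P j G) E V hV0]
    exact fresh_fieldMeasure (β 0) g
  | succ n ih =>
    intro hn g
    have hn' : n < e := Nat.lt_of_succ_le hn
    rw [map_restrict_traj_succ (fieldMeasure P j G) T E V hT hE hV0 hVs n]
    -- the restricted height-`n` measure is fresh at `β n = line (β (n+1)) (σ n (β (n+1)))`
    have hres : ∀ g' : G, ((((fieldMeasure P j G).restrict {U | ∀ i < n, V i U ∈ E i}).map (V n)).restrict (E n)).map
        (fun (W : GaugeField P (j + n) G) (b' : PBond P (j + n)) =>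
          W b' * ({line (β (n + 1)) (σ n (β (n + 1)))} : Set (PBond P (j + n))).mulIndicator (fun _ => g') b') =
        (((fieldMeasure P j G).restrict {U | ∀ i < n, V i U ∈ E i}).map (V n)).restrict (E n) := by
      intro g'
      rw [← hβσ n hn']
      exact fresh_restrict _ (β n) (ih hn'.le) (hE n) (hEβ n hn'.le) g'
    have hoff : ∀ U U' : GaugeField P (j + n) G, (∀ b', b' ≠ line (β (n + 1)) (σ n (β (n + 1))) → U b' = U' b') →
        ∀ c, c ≠ β (n + 1) → T n U c = T n U' c := by
      intro U U' h
      exact hTβ' n hn' U U' fun b' hb' => h b' (by rw [← hβσ n hn']; exact hb')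
    exact fresh_map_of_fresh (by omega) (σ n) (hσ n) (β (n + 1)) _ hres (hT n) (hTβ n hn') hoff g

omit [MeasurableMul₂ G] in
/-- **THE DEFECT CLIMBS THE TOWER**: two trajectories `V, V′` of families `T, T′` that coincide below `k`, differ at height `k` only at the coordinates in `D_{k+1}`, and coincide
again for `k < n < e`, where for those heights `E_n` is `D_n`-blind and the off-`D_{n+1}` coordinates of `T_n` are `D_n`-blind: the branch measures at height `n`, `k < n ≤ e`,
AGREE on every measurable `D_n`-blind set. [folklore] -/
theorem agreeOff_traj (k e : ℕ)
    (T T' : (n : ℕ) → GaugeField P (j + n) G → GaugeField P (j + n + 1) G) (hT : ∀ n, Measurable (T n)) (hT' : ∀ n, Measurable (T' n))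
    (hTT' : ∀ n, n ≠ k → T' n = T n)
    (E : (n : ℕ) → Set (GaugeField P (j + n) G)) (hE : ∀ n, MeasurableSet (E n))
    (V V' : (n : ℕ) → GaugeField P j G → GaugeField P (j + n) G) (hV0 : ∀ U, V 0 U = U) (hVs : ∀ n U, V (n + 1) U = T n (V n U))
    (hV0' : ∀ U, V' 0 U = U) (hVs' : ∀ n U, V' (n + 1) U = T' n (V' n U))
    (D : (n : ℕ) → Set (PBond P (j + n)))
    (hDk : ∀ U, ∀ c, c ∉ D (k + 1) → T k U c = T' k U c)
    (hED : ∀ n, k < n → n < e → ∀ U U' : GaugeField P (j + n) G, (∀ b, b ∉ D n → U b = U' b) → (U ∈ E n ↔ U' ∈ E n))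
    (hTD : ∀ n, k < n → n < e → ∀ U U' : GaugeField P (j + n) G, (∀ b, b ∉ D n → U b = U' b) → ∀ c, c ∉ D (n + 1) → T n U c = T n U' c) :
    ∀ n, k < n → n ≤ e → ∀ B : Set (GaugeField P (j + n) G), MeasurableSet B →
      (∀ W W' : GaugeField P (j + n) G, (∀ c, c ∉ D n → W c = W' c) → (W ∈ B ↔ W' ∈ B)) →
        (((fieldMeasure P j G).restrict {U | ∀ i < n, V i U ∈ E i}).map (V n)) B =
          (((fieldMeasure P j G).restrict {U | ∀ i < n, V' i U ∈ E i}).map (V' n)) B := by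
  -- below the toggle the trajectories coincide
  have hVV' : ∀ n, n ≤ k → ∀ U, V' n U = V n U := by
    intro n
    induction n with
    | zero => intro _ U; rw [hV0 U, hV0' U]
    | succ n ih =>
      intro hn U
      rw [hVs n U, hVs' n U, hTT' n (by omega), ih (by omega) U]
  have hsetk : ∀ n, n ≤ k + 1 → {U : GaugeField P j G | ∀ i < n, V' i U ∈ E i} = {U | ∀ i < n, V i U ∈ E i} := by
    intro n hn
    ext U
    simp only [mem_setOf_eq]
    exact ⟨fun h i hi => by rw [← hVV' i (by omega) U]; exact h i hi, fun h i hi => by rw [hVV' i (by omega) U]; exact h i hi⟩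
  intro n
  induction n with
  | zero => intro h; exact absurd h (Nat.not_lt_zero k)
  | succ n ih =>
    intro hkn hne B hB hBbl
    rw [map_restrict_traj_succ (fieldMeasure P j G) T E V hT hE hV0 hVs n,
      map_restrict_traj_succ (fieldMeasure P j G) T' E V' hT' hE hV0' hVs' n]
    rcases Nat.lt_succ_iff_lt_or_eq.1 hkn with hkn' | rfl
    · -- transport step: `k < n`
      have hTn : T' n = T n := hTT' n (ne_of_gt hkn')
      rw [hTn]
      exact agreeOff_map_restrict _ _ (D n) (D (n + 1)) (ih hkn' (by omega)) (hE n) (hED n hkn' (by omega)) (hT n)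
        (hTD n hkn' (by omega)) B hB hBbl
    · -- the toggled height `n = k`: equal inputs, two maps agreeing off `D (k+1)`
      have heq : ((fieldMeasure P j G).restrict {U | ∀ i < k, V' i U ∈ E i}).map (V' k) =
          ((fieldMeasure P j G).restrict {U | ∀ i < k, V i U ∈ E i}).map (V k) := by
        rw [hsetk k (Nat.le_succ k), show V' k = V k from funext (hVV' k le_rfl)]
      rw [heq]
      exact agreeOff_map_restrict_of_maps _ (D (k + 1)) (E k) (hT k) (hT' k) hDk B hB hBbl

/-- ★★★ **(M) MUTE-SITE COUPLING.**  Heights `0 … N` of the standing range (`j + N ≤ m + K`); measurable one-step maps `T, T′` between consecutive gauge-field levels with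
`T′_n = T_n` for `n ≠ k` and `T_k, T′_k` equal at every coordinate outside `D_{k+1}` (the two BRANCHES at a site toggled at height `k`); measurable guard events `E_n`; the two
trajectories `V, V′`.  TOWER (`k < n < e`): `E_n` and the off-`D_{n+1}` coordinates of `T_n` are `D_n`-blind.  EXIT at height `e` (`k < e < N`): `T_e` is the straight transporter
at the coordinate `C`, its other coordinates are blind to `D_e` and to the slot `β_e = line C (τ C)`, `E_e` is blind to `D_e` and to `β_e`; the slot is FRESH: a chain
`β_n = line β_{n+1} (σ_n β_{n+1})` (`n < e`) with every `E_n` `β_n`-blind and every `T_n`, and `T′_k`, axial at `β_{n+1}` with other coordinates `β_n`-blind.  THEN the two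
branch measures coincide: `(dU_j ↾ {∀ n < N, V_n ∈ E_n}).map V_N = (dU_j ↾ {∀ n < N, V′_n ∈ E_n}).map V′_N` — the alternating sum over the branch at a MUTE site vanishes
(`UV3BranchExpansionDomination.branchSum_eq_zero_of_mute`'s hypothesis, as measures). [cite: Balaban1985Averaging, (b) p.23; Balaban1987RG1, (0.4) p.253; Balaban1985UV3, (2) p.256] -/
theorem map_restrict_traj_eq_of_mute (N : ℕ) (hN : j + N ≤ P.m + P.K) (k e : ℕ) (hke : k < e) (heN : e < N)
    (T T' : (n : ℕ) → GaugeField P (j + n) G → GaugeField P (j + n + 1) G) (hT : ∀ n, Measurable (T n)) (hT' : ∀ n, Measurable (T' n))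
    (hTT' : ∀ n, n ≠ k → T' n = T n)
    (E : (n : ℕ) → Set (GaugeField P (j + n) G)) (hE : ∀ n, MeasurableSet (E n))
    (V V' : (n : ℕ) → GaugeField P j G → GaugeField P (j + n) G) (hV0 : ∀ U, V 0 U = U) (hVs : ∀ n U, V (n + 1) U = T n (V n U))
    (hV0' : ∀ U, V' 0 U = U) (hVs' : ∀ n U, V' (n + 1) U = T' n (V' n U))
    -- the defect and the tower
    (D : (n : ℕ) → Set (PBond P (j + n)))
    (hDk : ∀ U, ∀ c, c ∉ D (k + 1) → T k U c = T' k U c)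
    (hED : ∀ n, k < n → n < e → ∀ U U' : GaugeField P (j + n) G, (∀ b, b ∉ D n → U b = U' b) → (U ∈ E n ↔ U' ∈ E n))
    (hTD : ∀ n, k < n → n < e → ∀ U U' : GaugeField P (j + n) G, (∀ b, b ∉ D n → U b = U' b) → ∀ c, c ∉ D (n + 1) → T n U c = T n U' c)
    -- the exit
    (C : PBond P (j + e + 1)) (τ : PBond P (j + e + 1) → ℕ) (hτ : ∀ c, τ c < P.L)
    (hTeC : ∀ U, T e U C = axialAvg U C)
    (hTeD : ∀ U U' : GaugeField P (j + e) G, (∀ b, b ∉ D e → U b = U' b) → ∀ c, c ≠ C → T e U c = T e U' c)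
    (hTeβ : ∀ U U' : GaugeField P (j + e) G, (∀ b, b ≠ line C (τ C) → U b = U' b) → ∀ c, c ≠ C → T e U c = T e U' c)
    (hEeD : ∀ U U' : GaugeField P (j + e) G, (∀ b, b ∉ D e → U b = U' b) → (U ∈ E e ↔ U' ∈ E e))
    -- the fresh slot chain
    (β : (n : ℕ) → PBond P (j + n)) (hβe : β e = line C (τ C)) (σ : (n : ℕ) → PBond P (j + n + 1) → ℕ) (hσ : ∀ n c, σ n c < P.L)
    (hβσ : ∀ n, n < e → β n = line (β (n + 1)) (σ n (β (n + 1))))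
    (hEβ : ∀ n, n ≤ e → ∀ U U' : GaugeField P (j + n) G, (∀ b', b' ≠ β n → U b' = U' b') → (U ∈ E n ↔ U' ∈ E n))
    (hTβ : ∀ n, n < e → ∀ U, T n U (β (n + 1)) = axialAvg U (β (n + 1)))
    (hTβ' : ∀ n, n < e → ∀ U U' : GaugeField P (j + n) G, (∀ b', b' ≠ β n → U b' = U' b') → ∀ c, c ≠ β (n + 1) → T n U c = T n U' c)
    (hT'kβ : ∀ U, T' k U (β (k + 1)) = axialAvg U (β (k + 1)))
    (hT'kβ' : ∀ U U' : GaugeField P (j + k) G, (∀ b', b' ≠ β k → U b' = U' b') → ∀ c, c ≠ β (k + 1) → T' k U c = T' k U' c) :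
    ((fieldMeasure P j G).restrict {U | ∀ n < N, V n U ∈ E n}).map (V N) =
      ((fieldMeasure P j G).restrict {U | ∀ n < N, V' n U ∈ E n}).map (V' N) := by
  classical
  -- `T'` inherits the chain letters
  have hT'β : ∀ n, n < e → ∀ U, T' n U (β (n + 1)) = axialAvg U (β (n + 1)) := by
    intro n hn U
    by_cases hnk : n = k
    · subst hnk; exact hT'kβ U
    · rw [hTT' n hnk]; exact hTβ n hn U
  have hT'β' : ∀ n, n < e → ∀ U U' : GaugeField P (j + n) G, (∀ b', b' ≠ β n → U b' = U' b') → ∀ c, c ≠ β (n + 1) → T' n U c = T' n U' c := by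
    intro n hn U U' h c hc
    by_cases hnk : n = k
    · subst hnk; exact hT'kβ' U U' h c hc
    · rw [hTT' n hnk]; exact hTβ' n hn U U' h c hc
  -- (1) freshness of both height-`e` branch measures at `β e`, (2) agreement off `D e`
  have hfresh := fresh_traj e (by omega) T hT E hE V hV0 hVs β σ hσ hβσ hEβ hTβ hTβ' e le_rfl
  have hfresh' := fresh_traj e (by omega) T' hT' E hE V' hV0' hVs' β σ hσ hβσ hEβ hT'β hT'β' e le_rfl
  have hagree := agreeOff_traj k e T T' hT hT' hTT' E hE V V' hV0 hVs hV0' hVs' D hDk hED hTD e hke le_rfl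
  -- (3) the exit step: equality at height `e + 1`
  have hTe : T' e = T e := hTT' e (ne_of_gt hke)
  have heq : ((fieldMeasure P j G).restrict {U | ∀ n < e + 1, V n U ∈ E n}).map (V (e + 1)) =
      ((fieldMeasure P j G).restrict {U | ∀ n < e + 1, V' n U ∈ E n}).map (V' (e + 1)) := by
    rw [map_restrict_traj_succ (fieldMeasure P j G) T E V hT hE hV0 hVs e,
      map_restrict_traj_succ (fieldMeasure P j G) T' E V' hT' hE hV0' hVs' e, hTe]
    -- the two restricted height-`e` laws
    have hEβe : ∀ U U' : GaugeField P (j + e) G, (∀ b', b' ≠ β e → U b' = U' b') → (U ∈ E e ↔ U' ∈ E e) := hEβ e le_rfl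
    have hr : ∀ g : G, ((((fieldMeasure P j G).restrict {U | ∀ i < e, V i U ∈ E i}).map (V e)).restrict (E e)).map
        (fun (W : GaugeField P (j + e) G) (b' : PBond P (j + e)) =>
          W b' * ({line C (τ C)} : Set (PBond P (j + e))).mulIndicator (fun _ => g) b') =
        (((fieldMeasure P j G).restrict {U | ∀ i < e, V i U ∈ E i}).map (V e)).restrict (E e) := by
      intro g; rw [← hβe]; exact fresh_restrict _ (β e) hfresh (hE e) hEβe g
    have hr' : ∀ g : G, ((((fieldMeasure P j G).restrict {U | ∀ i < e, V' i U ∈ E i}).map (V' e)).restrict (E e)).map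
        (fun (W : GaugeField P (j + e) G) (b' : PBond P (j + e)) =>
          W b' * ({line C (τ C)} : Set (PBond P (j + e))).mulIndicator (fun _ => g) b') =
        (((fieldMeasure P j G).restrict {U | ∀ i < e, V' i U ∈ E i}).map (V' e)).restrict (E e) := by
      intro g; rw [← hβe]; exact fresh_restrict _ (β e) hfresh' (hE e) hEβe g
    have hΦΛ : ∀ U, ∀ c ∈ ({C} : Set (PBond P (j + e + 1))), T e U c = axialAvg U c := fun U c hc => by
      rw [Set.mem_singleton_iff.1 hc]; exact hTeC U
    have hΦoff : ∀ U U' : GaugeField P (j + e) G, (∀ b, (¬ ∃ c ∈ ({C} : Set (PBond P (j + e + 1))), line c (τ c) = b) → U b = U' b) →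
        ∀ c, c ∉ ({C} : Set (PBond P (j + e + 1))) → T e U c = T e U' c := by
      intro U U' h c hc
      refine hTeβ U U' (fun b hb => h b ?_) c hc
      rintro ⟨c', hc', rfl⟩
      exact hb (by rw [Set.mem_singleton_iff.1 hc'])
    -- the blanked images agree: they do not read `D e`
    have hblank : Measurable fun U : GaugeField P (j + e) G =>
        (({C} : Set (PBond P (j + e + 1))).piecewise 1 (T e U) : GaugeField P (j + e + 1) G) :=
      measurable_piecewise_overwrite ({C} : Set (PBond P (j + e + 1))) (hT e) measurable_const
    have hblind : ∀ U U' : GaugeField P (j + e) G, (∀ b, b ∉ D e → U b = U' b) →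
        (({C} : Set (PBond P (j + e + 1))).piecewise 1 (T e U) : GaugeField P (j + e + 1) G) = ({C} : Set (PBond P (j + e + 1))).piecewise 1 (T e U') := by
      intro U U' h
      funext c
      by_cases hc : c ∈ ({C} : Set (PBond P (j + e + 1)))
      · rw [Set.piecewise_eq_of_mem _ _ _ hc, Set.piecewise_eq_of_mem _ _ _ hc]
      · rw [Set.piecewise_eq_of_notMem _ _ _ hc, Set.piecewise_eq_of_notMem _ _ _ hc]
        exact hTeD U U' h c hc
    have hagreeR : ∀ B : Set (GaugeField P (j + e) G), MeasurableSet B →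
        (∀ W W' : GaugeField P (j + e) G, (∀ c, c ∉ D e → W c = W' c) → (W ∈ B ↔ W' ∈ B)) →
          ((((fieldMeasure P j G).restrict {U | ∀ i < e, V i U ∈ E i}).map (V e)).restrict (E e)) B =
            ((((fieldMeasure P j G).restrict {U | ∀ i < e, V' i U ∈ E i}).map (V' e)).restrict (E e)) B := by
      intro B hB hBbl
      have h := agreeOff_map_restrict _ _ (D e) (D e) hagree (hE e) hEeD measurable_id (fun U U' h c hc => h c hc) B hB hBbl
      rwa [Measure.map_id, Measure.map_id] at h
    have hmarg := map_eq_of_agreeOff _ _ (D e) hagreeR hblank hblind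
    exact map_eq_of_marginal_eq (by omega) τ hτ ({C} : Set (PBond P (j + e + 1))) (hT e) hΦΛ hΦoff _ _
      (shear_of_fresh (by omega) τ hτ C _ hr) (shear_of_fresh (by omega) τ hτ C _ hr') hmarg
  -- (4) above the exit the maps coincide
  have hup : ∀ d : ℕ, ((fieldMeasure P j G).restrict {U | ∀ n < e + 1 + d, V n U ∈ E n}).map (V (e + 1 + d)) =
      ((fieldMeasure P j G).restrict {U | ∀ n < e + 1 + d, V' n U ∈ E n}).map (V' (e + 1 + d)) := by
    intro d
    induction d with
    | zero => exact heq
    | succ d ih =>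
      rw [show e + 1 + (d + 1) = e + 1 + d + 1 from rfl,
        map_restrict_traj_succ (fieldMeasure P j G) T E V hT hE hV0 hVs (e + 1 + d),
        map_restrict_traj_succ (fieldMeasure P j G) T' E V' hT' hE hV0' hVs' (e + 1 + d), ih, hTT' (e + 1 + d) (by omega)]
  obtain ⟨d, rfl⟩ : ∃ d, N = e + 1 + d := ⟨N - (e + 1), by omega⟩
  exact hup d

end Summit.QuantumFields.YangMills.Theorems.UV3BranchExpansionMuteCoupling

end
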